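/-
Copyright: lit-balaban Phase-2 proof seat p31 (gen 2).  Statement-level skeleton of a published paper; no proof claims beyond what the
kernel checks below.
-/
import Literature.MathematicalPhysics.QuantumFieldTheory.BalabanImbrieJaffe1984to88.BIJ85Eq219Proof
import Literature.MathematicalPhysics.QuantumFieldTheory.Balaban1983to89.B7SectAStatements

/-!
# `BalabanImbrieJaffe1984to88.BIJ85Eq224Proof` — T. Bałaban, J. Imbrie, A. Jaffe, *Renormalization of the Higgs model: minimizers,
propagators and the stability of mean field theory*, Commun. Math. Phys. **97** (1985) 299–329 [BalabanImbrieJaffe1985]: **(2.24)**,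
the k-fold surface averages `Q^s_k = (Q^s)^k`, `Q^{s*}_k` ON THE TORI and `Q^s_kQ^{s*}_k = L^kI = η^{−1}I` PROVED

statement-level skeleton of published theorems with citation tags; proofs where landed; nothing here is a claim about the Yang–Mills mass gap

PDF held: `paper:balaban1985-cmp97-bij-higgs-minimizers` (journal page = PDF page + 298).  Pages read as images:
`run/shared/lean/pub/lit-balaban/lit-balaban-r15/pages/1985-cmp97-bij-higgs-minimizers-p006-x2.png` (p. 304), `…-p007-x2.png` (p. 305),
`…-p014-x2.png` (p. 312).

CITATION HEADER (lean-in-tree rule).  Part of the lit-balaban TYPED SKELETON (HOME `run/shared/lean/pub/lit-balaban/`), Phase-2 seat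
p31 (gen 2), row **C1.Eq2.24** of `HOME/SKELETON.md` (reader file `HOME/lit-balaban-r15/ROWS-C1.md`).  WHAT IS REPRODUCED, and how.
p. 305 [PDF 7], verbatim: *"We also need the k-fold averaging operators Q_k ≡ (Q)^k, etc. Especially important are Q^e_k ≡ (Q^e)^k and
Q^s_k = (Q^s)^k which satisfy Q^e_kQ^{e*}_k = L^{2k}I = η^{−2}I, Q^s_kQ^{s*}_k = L^kI = η^{−1}I, (2.24) where η = L^{−k}."*; p. 309
[PDF 11]: *"Q_k is given by the formula (2.13), where L is replaced by L^k"*; p. 312 [PDF 14], (4.5.3): *"(Q^{s*}_kv)_b = 1 if b is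
strictly contained in a k-block (both endpoints belong to the block), v_c if the η-lattice bond b belongs to the corridor of bonds
connecting the two blocks B^k(c₋) and B^k(c₊)"*.  The row was TYPED (p240655) as the instance, at block size `L^k`, of the identities
`QQ^* = L^m·I` of the uniform carrier — *that the k-th iterate of the one-step average IS the L^k-block average being "the instance's"*.
This file supplies that instance and that identification ON THE TORI of `Setup`, for the SURFACE averages (m = 1; the edge averages,
m = 2, and the k-fold `∂Q^{s*}_k = Q^{e*}_k∂` are the companion `BIJ85Eq224ProofPart2`):
* §1 the k-fold two-scale bond geometry `torusBlockBondsIter P i k` of `T^{(i)} ⊃ T^{(i+k)}` (an instance of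
  `BIJ85Sect2SurfaceAverages.BlockBonds`: block map = the k-fold block map `…Balaban1983to89.B7SectAStatements.blockOfIter k`, block size
  `L^k`), whose surface sets `B^s_k(c)` are the printed corridors (`mem_BsIter_iff`), with the kernel geometry: the k-fold block point of the
  far endpoint of a fine bond is that of its near endpoint or the next one (`blockOfIter_shift`), hence **`B^s_{k+1}(c) = ⨆_{b̄ ∈ B^s(c)}
  B^s_k(b̄)`** (a fine bond is a (k+1)-surface bond of `c` iff its k-fold block bond `b̄` is a surface bond of `c` and it is a k-surface
  bond of `b̄`: `mem_BsIter_succ_iff`, `barBond_eq_of_mem`) and the count `|B^s_k(c)| = L^{k(d−1)}` (`card_BsIter`);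
* §2 **`Q^{s*}_{k+1} = Q^{s*}_kQ^{s*}`** and **`Q^s_{k+1} = Q^sQ^s_k`** (`QsstarIter_succ`, `QsIter_succ`; `Q^s_0 = Q^{s*}_0 = I`,
  `QsIter_zero`, `QsstarIter_zero`) — i.e. the printed `Q^s_k = (Q^s)^k` with `Q^s` = (2.16) and `Q^{s*}` = (2.17) of the one-step torus
  geometry `BIJ85Eq219Proof.torusBlockBonds` at each level; and **(2.24)**, `Q^s_kQ^{s*}_k = L^kI = η^{−1}I` OUTRIGHT (`Qs_Qsstar_iter`,
  `Qs_Qsstar_iter_eta`, η = `Params.eta k`), `Q^{s*}_kQ^s_k = L^kP^s_k` with `P^s_k` a projection (`Ps_iter_idem`).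
Standing range `i + k ≤ m + K` of `Setup` throughout.  NOT here: the linear average `Q_k = Q^k` of (2.13) (its one-stroke form is
`…Balaban1983to89.B5Eq118OneStroke.eq118`, base level 0), the edge averages (Part 2).  Unit `lit-balaban-p31`
(literature-prover-lit-balaban-p31-g2-0), 2026-08-21.
-/

open scoped BigOperators

namespace Literature.MathematicalPhysics.QuantumFieldTheory.BalabanImbrieJaffe1984to88.BIJ85Eq224Proof

open Literature.MathematicalPhysics.QuantumFieldTheory.Balaban1983to89
open BIJ85Sect2SurfaceAverages LatticeFieldCalculus BIJ85Eq219Proof B7SectAStatements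

variable {P : Params} {i : ℕ}

/-! ## 0. Torus bookkeeping -/

/-- `y + e_μ ≠ y` on every torus of the series (`1 ≠ 0` in `ZMod (2L^{m+K−j})`). [folklore] -/
private theorem shift_ne_self {j : ℕ} (y : Balaban1983to89.Site P j) (μ : Fin P.d) : y.shift μ ≠ y := by
  intro h
  have h1 := congrFun h μ
  simp only [Balaban1983to89.Site.shift, Function.update_self] at h1
  exact one_ne_zero (add_eq_left.1 h1)

/-- A positively oriented bond has distinct endpoints. [folklore] -/
private theorem src_ne_tgt {j : ℕ} (c : PBond P j) : c.src ≠ c.tgt := fun h => shift_ne_self c.src c.dir h.symm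

/-- The direction of a lattice step is determined by its effect. [folklore] -/
private theorem dir_eq_of_shift_eq {j : ℕ} (y : Balaban1983to89.Site P j) {μ ν : Fin P.d} (h : y.shift μ = y.shift ν) : μ = ν := by
  by_contra hne
  have h1 := congrFun h μ
  simp only [Balaban1983to89.Site.shift, Function.update_self, Function.update_of_ne hne] at h1
  exact one_ne_zero (add_eq_left.1 h1)

/-- A positively oriented bond is determined by its ordered endpoints. [folklore] -/
private theorem pbond_ext {j : ℕ} {c c' : PBond P j} (hs : c.src = c'.src) (ht : c.tgt = c'.tgt) : c = c' := by
  have hd : c.dir = c'.dir := by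
    apply dir_eq_of_shift_eq c.src
    have ht' : c.src.shift c.dir = c'.src.shift c'.dir := ht
    rw [← hs] at ht'
    exact ht'
  rcases c with ⟨s, μ⟩
  rcases c' with ⟨s', μ'⟩
  simp only at hs hd
  subst hs
  subst hd
  rfl

/-- THE KERNEL GEOMETRY OF THE k-FOLD BLOCKS: the k-fold block point of the far endpoint `x + e_μ` of a fine bond is the k-fold block point `z`
of `x` or its neighbour `z + e_μ` (a bond lies strictly inside a k-block or in the corridor between two adjacent k-blocks, p. 312;
standing range). [cite: BalabanImbrieJaffe1985, (4.5.3) p.312] -/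
theorem blockOfIter_shift : ∀ (k : ℕ), i + k ≤ P.m + P.K → ∀ (x : Balaban1983to89.Site P i) (μ : Fin P.d),
    blockOfIter k (x.shift μ) = blockOfIter k x ∨ blockOfIter k (x.shift μ) = (blockOfIter k x).shift μ
  | 0, _, _, _ => Or.inr rfl
  | k + 1, hk, x, μ => by
    simp only [blockOfIter_succ]
    rcases blockOfIter_shift k (by omega) x μ with h | h
    · exact Or.inl (by rw [h])
    · rw [h]
      exact blockOf_tgt (by omega : i + k + 1 ≤ P.m + P.K) ⟨blockOfIter k x, μ⟩

/-! ## 1. The k-fold two-scale bond geometry of the tori and its surface sets `B^s_k(c)` -/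

/-- BIJ's two-scale bond geometry (2.15) AT BLOCK SIZE `L^k` (p. 309: *"Q_k is given by the formula (2.13), where L is replaced by
L^k"*; p. 305: *"the k-fold averaging operators"*) INSTANTIATED BY THE TORI of the series: fine lattice `T^{(i)}` (`Site P i`, bonds
`PBond P i`), coarse lattice `T^{(i+k)}`, block map = the k-fold block map `B7SectAStatements.blockOfIter k` (`x ∈ B^k(y)`), block size
`L^k`, dimension `d`; the two geometric fields of `BlockBonds` PROVED as in `BIJ85Eq219Proof.torusBlockBonds`.  Its `Bs c` is the corridor
*"of bonds connecting the two blocks B^k(c₋) and B^k(c₊)"* (p. 312), its `Qs`/`Qsstar` are `Q^s_k`, `Q^{s*}_k` of (2.24).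
[cite: BalabanImbrieJaffe1985, (2.24) p.305] -/
@[reducible] noncomputable def torusBlockBondsIter (P : Params) (i k : ℕ) : BlockBonds where
  X := Balaban1983to89.Site P i
  Y := Balaban1983to89.Site P (i + k)
  FB := PBond P i
  CB := PBond P (i + k)
  fbFintype := inferInstance
  cbFintype := inferInstance
  fbDecEq := Classical.decEq _
  yDecEq := inferInstance
  src := PBond.src
  tgt := PBond.tgt
  csrc := PBond.src
  ctgt := PBond.tgt
  blk := blockOfIter k
  L := P.L ^ k
  d := P.d
  one_le_L := Nat.one_le_pow _ _ P.L_pos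
  one_le_d := P.hd
  cbond_ext := fun _ _ hs ht => pbond_ext hs ht
  cbond_ne := fun c => src_ne_tgt c

/-- plumbing: the block size of the k-fold geometry is `L^k`. [cite: BalabanImbrieJaffe1985, (2.24) p.305] -/
theorem iter_L (k : ℕ) : (torusBlockBondsIter P i k).L = P.L ^ k := rfl

/-- plumbing: the block size of the one-step geometry is `L`. [cite: BalabanImbrieJaffe1985, (2.15) p.304] -/
theorem one_L (j : ℕ) : (torusBlockBonds P j).L = P.L := rfl

/-- kernel: membership in the k-fold surface set `B^s_k(c)` on the tori: `b₋ ∈ B^k(c₋)` and `b₊ ∈ B^k(c₊)` (the corridor between the two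
k-blocks, p. 312). [cite: BalabanImbrieJaffe1985, (4.5.3) p.312] -/
theorem mem_BsIter_iff (k : ℕ) (c : PBond P (i + k)) (b : PBond P i) :
    b ∈ (torusBlockBondsIter P i k).Bs c ↔ blockOfIter k b.src = c.src ∧ blockOfIter k b.tgt = c.tgt :=
  (torusBlockBondsIter P i k).mem_Bs c b

/-- kernel: at k = 0 (no coarsening, block size 1) the surface set of a bond is the bond itself. [cite: BalabanImbrieJaffe1985, (2.24) p.305] -/
theorem BsIter_zero (c : PBond P i) : (torusBlockBondsIter P i 0).Bs c = {c} := by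
  ext b
  rw [mem_BsIter_iff, Finset.mem_singleton]
  constructor
  · rintro ⟨h1, h2⟩
    exact pbond_ext h1 h2
  · rintro rfl
    exact ⟨rfl, rfl⟩

/-- THE NESTING OF THE CORRIDORS: a fine bond `b` is a (k+1)-surface bond of `c` iff its k-fold block bond `b̄ = ⟨blockOfIter k b₋, dir b⟩` is
a surface bond of `c` (one step, level `i + k`) and `b` is a k-surface bond of `b̄` — `B^s_{k+1}(c) = ⋃_{b̄ ∈ B^s(c)} B^s_k(b̄)`
(standing range). [cite: BalabanImbrieJaffe1985, (2.24) p.305] -/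
theorem mem_BsIter_succ_iff {k : ℕ} (hk : i + k + 1 ≤ P.m + P.K) (c : PBond P (i + k + 1)) (b : PBond P i) :
    b ∈ (torusBlockBondsIter P i (k + 1)).Bs c ↔
      (⟨blockOfIter k b.src, b.dir⟩ : PBond P (i + k)) ∈ (torusBlockBonds P (i + k)).Bs c ∧
        b ∈ (torusBlockBondsIter P i k).Bs ⟨blockOfIter k b.src, b.dir⟩ := by
  rw [mem_BsIter_iff, mem_BsIter_iff, mem_Bs_iff]
  simp only [blockOfIter_succ]
  constructor
  · rintro ⟨h1, h2⟩
    have ht : blockOfIter k b.tgt = (blockOfIter k b.src).shift b.dir := by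
      rcases blockOfIter_shift k (by omega) b.src b.dir with h | h
      · exfalso
        apply src_ne_tgt c
        rw [← h1, ← h2]
        exact congrArg blockOf h.symm
      · exact h
    exact ⟨⟨h1, by rw [← h2, ht]; rfl⟩, trivial, ht⟩
  · rintro ⟨⟨h1, h2⟩, -, h4⟩
    refine ⟨h1, ?_⟩
    rw [h4]
    exact h2

/-- kernel: the k-fold block bond is the ONLY bond whose k-surface set contains a given fine bond (a surface bond lies in one corridor, and
the corridor determines the coarse bond; standing range). [cite: BalabanImbrieJaffe1985, (4.5.3) p.312] -/
theorem barBond_eq_of_mem {k : ℕ} (hk : i + k ≤ P.m + P.K) {bb : PBond P (i + k)} {b : PBond P i}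
    (h : b ∈ (torusBlockBondsIter P i k).Bs bb) : bb = ⟨blockOfIter k b.src, b.dir⟩ := by
  rw [mem_BsIter_iff] at h
  obtain ⟨h1, h2⟩ := h
  rcases bb with ⟨s, μ⟩
  simp only at h1 h2
  change blockOfIter k (b.src.shift b.dir) = s.shift μ at h2
  have hdir : μ = b.dir := by
    rcases blockOfIter_shift k hk b.src b.dir with h | h
    · exact absurd (h2.symm.trans (h.trans h1)) (shift_ne_self s μ)
    · exact dir_eq_of_shift_eq s (h2.symm.trans (h.trans (by rw [h1])))
  subst hdir
  rw [← h1]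

/-- The printed count behind (2.24): the corridor between two adjacent k-blocks carries `L^{k(d−1)}` fine bonds, `|B^s_k(c)| = (L^k)^{d−1}` on
the tori (induction on `k` through the nesting `mem_BsIter_succ_iff` and the one-step count `BIJ85Eq219Proof.card_Bs`; standing range).
[cite: BalabanImbrieJaffe1985, (2.24) p.305] -/
theorem card_BsIter : ∀ (k : ℕ), i + k ≤ P.m + P.K → ∀ c : PBond P (i + k),
    ((torusBlockBondsIter P i k).Bs c).card = (P.L ^ k) ^ (P.d - 1)
  | 0, _, c => by rw [BsIter_zero, Finset.card_singleton, pow_zero, one_pow]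
  | k + 1, hk, c => by
    classical
    have hunion : (torusBlockBondsIter P i (k + 1)).Bs c =
        ((torusBlockBonds P (i + k)).Bs c).biUnion fun bb => (torusBlockBondsIter P i k).Bs bb := by
      ext b
      rw [Finset.mem_biUnion, mem_BsIter_succ_iff hk]
      constructor
      · rintro ⟨h1, h2⟩
        exact ⟨_, h1, h2⟩
      · rintro ⟨bb, h1, h2⟩
        obtain rfl := barBond_eq_of_mem (by omega) h2
        exact ⟨h1, h2⟩
    rw [hunion, Finset.card_biUnion (fun bb _ bb' _ hne => Finset.disjoint_left.mpr fun b hb hb' =>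
      hne ((torusBlockBondsIter P i k).Bs_unique hb hb'))]
    rw [Finset.sum_congr rfl fun bb _ => card_BsIter k (by omega) bb, Finset.sum_const,
      card_Bs (by omega : i + k + 1 ≤ P.m + P.K) c, smul_eq_mul, ← mul_pow, ← pow_succ']

/-! ## 2. `Q^{s*}_{k+1} = Q^{s*}_kQ^{s*}`, `Q^s_{k+1} = Q^sQ^s_k`, and (2.24) -/

/-- kernel: `Q^{s*}_0 = I` (block size 1). [cite: BalabanImbrieJaffe1985, (2.24) p.305] -/
theorem QsstarIter_zero (B : PBond P i → ℝ) : (torusBlockBondsIter P i 0).Qsstar B = B := by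
  funext b
  have hb : b ∈ (torusBlockBondsIter P i 0).Bs b := by rw [BsIter_zero]; exact Finset.mem_singleton_self b
  rw [(torusBlockBondsIter P i 0).Qsstar_of_mem B hb, iter_L, pow_zero, Nat.cast_one, one_mul]

/-- kernel: `Q^s_0 = I` (block size 1). [cite: BalabanImbrieJaffe1985, (2.24) p.305] -/
theorem QsIter_zero (A : PBond P i → ℝ) : (torusBlockBondsIter P i 0).Qs A = A := by
  funext c
  unfold BlockBonds.Qs
  rw [BsIter_zero, Finset.sum_singleton, iter_L, pow_zero, Nat.cast_one, one_pow, inv_one, one_mul]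

/-- **`Q^{s*}_{k+1} = Q^{s*}_k Q^{s*}`** — the adjoint of the printed `Q^s_{k+1} = Q^sQ^s_k` (*"Q^s_k = (Q^s)^k"*, (2.24)): the k-fold pull-back
(2.17) at block size `L^{k+1}` is the k-fold pull-back at block size `L^k` of the one-step pull-back at level `i + k` (values `L^{k+1}B(c)`
on the (k+1)-corridor of `c`, `0` elsewhere, on both sides; standing range). [cite: BalabanImbrieJaffe1985, (2.24) p.305] -/
theorem QsstarIter_succ {k : ℕ} (hk : i + k + 1 ≤ P.m + P.K) (B : PBond P (i + k + 1) → ℝ) :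
    (torusBlockBondsIter P i (k + 1)).Qsstar B =
      (torusBlockBondsIter P i k).Qsstar ((torusBlockBonds P (i + k)).Qsstar B) := by
  funext b
  by_cases h : ∃ c, b ∈ (torusBlockBondsIter P i (k + 1)).Bs c
  · obtain ⟨c, hc⟩ := h
    have h' := (mem_BsIter_succ_iff hk c b).mp hc
    rw [(torusBlockBondsIter P i (k + 1)).Qsstar_of_mem B hc, (torusBlockBondsIter P i k).Qsstar_of_mem _ h'.2,
      (torusBlockBonds P (i + k)).Qsstar_of_mem B h'.1, iter_L, iter_L, one_L]
    push_cast
    ring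
  · push Not at h
    rw [(torusBlockBondsIter P i (k + 1)).Qsstar_of_not_mem B h]
    by_cases h2 : ∃ bb, b ∈ (torusBlockBondsIter P i k).Bs bb
    · obtain ⟨bb, hbb⟩ := h2
      rw [(torusBlockBondsIter P i k).Qsstar_of_mem _ hbb, (torusBlockBonds P (i + k)).Qsstar_of_not_mem B, mul_zero]
      intro c hc
      apply h c
      obtain rfl := barBond_eq_of_mem (by omega) hbb
      exact (mem_BsIter_succ_iff hk c b).mpr ⟨hc, hbb⟩
    · push Not at h2
      rw [(torusBlockBondsIter P i k).Qsstar_of_not_mem _ h2]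

/-- **`Q^s_{k+1} = Q^sQ^s_k`** — the printed *"Q^s_k = (Q^s)^k"* of (2.24): the surface average (2.16) at block size `L^{k+1}` is the one-step
surface average at level `i + k` of the surface average at block size `L^k` (the (k+1)-corridor is the disjoint union of the k-corridors
of the bonds of the 1-corridor, `L^{−k(d−1)}·L^{−(d−1)} = L^{−(k+1)(d−1)}`; standing range). [cite: BalabanImbrieJaffe1985, (2.24) p.305] -/
theorem QsIter_succ {k : ℕ} (hk : i + k + 1 ≤ P.m + P.K) (A : PBond P i → ℝ) :
    (torusBlockBondsIter P i (k + 1)).Qs A = (torusBlockBonds P (i + k)).Qs ((torusBlockBondsIter P i k).Qs A) := by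
  classical
  funext c
  have hunion : (torusBlockBondsIter P i (k + 1)).Bs c =
      ((torusBlockBonds P (i + k)).Bs c).biUnion fun bb => (torusBlockBondsIter P i k).Bs bb := by
    ext b
    rw [Finset.mem_biUnion, mem_BsIter_succ_iff hk]
    constructor
    · rintro ⟨h1, h2⟩
      exact ⟨_, h1, h2⟩
    · rintro ⟨bb, h1, h2⟩
      obtain rfl := barBond_eq_of_mem (by omega) h2
      exact ⟨h1, h2⟩
  unfold BlockBonds.Qs
  rw [hunion, Finset.sum_biUnion (fun bb _ bb' _ hne => Finset.disjoint_left.mpr fun b hb hb' =>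
    hne ((torusBlockBondsIter P i k).Bs_unique hb hb')), iter_L, iter_L, one_L, Finset.mul_sum, Finset.mul_sum]
  refine Finset.sum_congr rfl fun bb _ => ?_
  have hL : (P.L : ℝ) ≠ 0 := Nat.cast_ne_zero.mpr P.L_pos.ne'
  push_cast
  rw [← mul_assoc]
  congr 1
  rw [pow_succ', mul_pow, mul_inv]

/-- **(2.24)** p. 305 [PDF 7], surface part, verbatim: *"Q^s_kQ^{s*}_k = L^kI = η^{−1}I"* — PROVED OUTRIGHT on the tori of the series for the
k-fold surface geometry `torusBlockBondsIter` (the count `|B^s_k(c)| = L^{k(d−1)}` discharged by `card_BsIter`; standing range).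
[cite: BalabanImbrieJaffe1985, (2.24) p.305] -/
theorem Qs_Qsstar_iter {k : ℕ} (hk : i + k ≤ P.m + P.K) (B : PBond P (i + k) → ℝ) (c : PBond P (i + k)) :
    (torusBlockBondsIter P i k).Qs ((torusBlockBondsIter P i k).Qsstar B) c = (P.L : ℝ) ^ k * B c := by
  rw [(torusBlockBondsIter P i k).Qs_Qsstar (card_BsIter k hk) B c, iter_L]
  push_cast
  ring

/-- **(2.24)** p. 305 [PDF 7], surface part in the η-form, verbatim: *"Q^s_kQ^{s*}_k = L^kI = η^{−1}I, (2.24) where η = L^{−k}"* — with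
`η = Params.eta k = (L⁻¹)^k` of `Setup` (standing range). [cite: BalabanImbrieJaffe1985, (2.24) p.305] -/
theorem Qs_Qsstar_iter_eta {k : ℕ} (hk : i + k ≤ P.m + P.K) (B : PBond P (i + k) → ℝ) (c : PBond P (i + k)) :
    (torusBlockBondsIter P i k).Qs ((torusBlockBondsIter P i k).Qsstar B) c = (P.eta k)⁻¹ * B c := by
  rw [Qs_Qsstar_iter hk, Params.eta, inv_pow, inv_inv]

/-- **(2.24)** with (2.18): `Q^{s*}_kQ^s_k = L^kP^s_k` where `P^s_k` (the average over the k-corridor containing the bond, zero on bonds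
interior to a k-block) IS a projection on the tori — idempotent outright (`BIJ85Eq219Proof.blockBonds_Ps_idem` with the count
`card_BsIter`), the identity itself being `BlockBonds.Qsstar_Qs` (standing range). [cite: BalabanImbrieJaffe1985, (2.24) p.305] -/
theorem Ps_iter_idem {k : ℕ} (hk : i + k ≤ P.m + P.K) (A : PBond P i → ℝ) (b : PBond P i) :
    (torusBlockBondsIter P i k).Ps ((torusBlockBondsIter P i k).Ps A) b = (torusBlockBondsIter P i k).Ps A b :=
  blockBonds_Ps_idem (torusBlockBondsIter P i k) (card_BsIter k hk) A b

end Literature.MathematicalPhysics.QuantumFieldTheory.BalabanImbrieJaffe1984to88.BIJ85Eq224Proof
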